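import Literature.NumberTheory.PAdicHodge.LubinTateAinfTorsionLift
import Literature.NumberTheory.PAdicHodge.AinfRamifiedVarpi
import Literature.NumberTheory.PAdicHodge.AinfRamifiedKernel
import Literature.NumberTheory.PAdicHodge.AinfWeierstrassHodgeTateNonvanishing
import HarnessLib

/-!
# Fontaine's element of a Lubin–Tate division tower is transverse to `ω² A_inf(𝒪)` (tilt-valuation test)

Topic `Literature/NumberTheory/PAdicHodge`; THEOREMS ONLY; sequel of `LubinTateAinfTorsionLift` (Fontaine's element
`x_t ∈ ker θ_𝒪 = ω A_inf(𝒪)` of a division tower `t` of `P = c·X + X^q` over `𝒪_D = ℤ_p[ϖ]`), `AinfRamifiedVarpi`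
(`modVarpi : A_inf(𝒪) → A_inf(𝒪)/ϖ = 𝒪_{ℂ_F}♭`) and `AinfRamifiedKernel` (`ω = ϖ − [ϖ♭]`, `ker θ_𝒪 = (ω)`).
For the uniformizer itself, `c = ϖ` (so `P = ϖX + X^q` is the Lubin–Tate polynomial of `(ℚ_p(ϖ), ϖ)` when `q = p`, and of
an unramified `(F, p)` when `D = (X − p)`, `q = #k_F`), and `q ≥ 3`:

* §1 `AinfRam.norm_theta_sub_untilt_modVarpi_le` — **`θ_𝒪(z) ≡ (z mod ϖ)♯ (mod ϖ𝒪_{ℂ_F})`**: the ramified twin of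
  `θ(x) ≡ (x mod p)♯ (mod p)` (tree `AinfTop`-side `fontaineTheta_sub_untilt_constantCoeff_mem`); `modVarpi ω = −ϖ♭`.
* §2 **`ltTorsionLift_not_dvd_omega_sq`** — for a division tower `t` (`ϖ t_{n+1} + t_{n+1}^q = t_n`) with `t₀ = 0 ≠ t₁`:
  **`ω² ∤ x_t`**. Proof (Tate's valuation test on the tilt): `x_t = ϖ x_{t⁺} + x_{t⁺}^q` (shift relation), so modulo `ϖ`,
  `x̄_t = x̄_{t⁺}^q`; if `x_t = ω² y` then `x̄_t = (ϖ♭)² ȳ`, and untilting, `‖x̄_{t⁺}♯‖^q ≤ ‖ϖ‖²`; but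
  `θ_𝒪(x_{t⁺}) = t₁` with `‖t₁‖^{q-1} = ‖ϖ‖` (`ϖ t₁ = −t₁^q`), so `‖ϖ‖ < ‖t₁‖` and §1 gives `‖x̄_{t⁺}♯‖ = ‖t₁‖`, whence
  `‖t₁‖^q ≤ ‖t₁‖^{2(q-1)} < ‖t₁‖^q` (`q ≥ 3`), a contradiction.

With `A_inf(𝒪) ∩ Fil² B_dR⁺ = ω² A_inf(𝒪)` (tree `AinfRam.omega_pow_dvd_of_toBdR_mem_span_pow`) this is the statement that the
Lubin–Tate period `t_LT = λ_f(ι x_t)` lies in `Fil¹ ∖ Fil²`, i.e. that `χ_π` has a Hodge–Tate weight equal to `1` at the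
identity embedding (Tate 1967 §3.3 for Lubin–Tate groups; Colmez 1993 §I.2). For `q = 2` (`F = ℚ₂`, or `ℚ_2(ϖ)` quadratic
ramified) the test is inconclusive (`‖t₁‖ = ‖ϖ‖`) and is not treated here. No definitions, no named facts, no `sorry`.
Nothing about Galois characters is proved here.

## References
* J. T. Tate, *p-divisible groups* (1967), §3.3, §4. [Tate1967]
* P. Colmez, *Périodes des variétés abéliennes à multiplication complexe*, Ann. of Math. 138 (1993), §I.2. [Colmez1993]
* J.-M. Fontaine, Astérisque 223 (1994), Exp. II §1.2.2. [FontaineAsterisque223III]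
* L. Fargues, J.-M. Fontaine, Astérisque 406 (2018), §1.2, §2.2. [FarguesFontaine2018]
-/

noncomputable section

open Ideal Field ValuativeRel Filter Topology WittVector

namespace Literature.NumberTheory.PAdicHodge

open Literature.NumberTheory.GaloisRepresentations
open Literature.NumberTheory.GaloisRepresentations.IsNonarchimedeanLocalField
open Literature.NumberTheory.GaloisRepresentations.LubinTate

variable {F : Type} [Field F] [ValuativeRel F] [TopologicalSpace F] [IsNonarchimedeanLocalField F] [CharZero F]
  {p : ℕ} [Fact p.Prime] [Fact (¬ IsUnit (p : integerC F))] [IsAdicComplete (Ideal.span {(p : integerC F)}) (integerC F)]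
  {hp : valuation F p < 1} {D : EisensteinRoot F p hp}

/-! ## §1 `θ_𝒪(z) ≡ (z mod ϖ)♯ (mod ϖ)` and `ω mod ϖ = −ϖ♭` -/

namespace AinfRam

variable (D)

omit [IsAdicComplete (Ideal.span {(p : integerC F)}) (integerC F)] in
/-- **`modVarpi ω = −ϖ♭`** (`ω = ϖ − [ϖ♭]`, `ϖ ↦ 0`, `[y] ↦ y`). [cite: FarguesFontaine2018, §2.2] -/
theorem modVarpi_omega : modVarpi D (omega D) = -D.rootFlat := by
  rw [omega_def, map_sub, modVarpi_varpi, modVarpi_algebraMap, WittVector.constantCoeff_apply, teichmuller_coeff_zero, zero_sub]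

omit [Fact (¬ IsUnit (p : integerC F))] [IsAdicComplete (Ideal.span {(p : integerC F)}) (integerC F)] in
/-- `‖p‖ ≤ ‖ϖ‖` in `ℂ_F` (`‖ϖ‖^e = ‖p‖`, `‖ϖ‖ ≤ 1`, `e ≥ 1`). [cite: SerreLocalFields1979, Ch. I §6 Prop. 17] -/
theorem norm_natCast_le_norm_root :
    ‖(p : CompletedAlgClosure F)‖ ≤ ‖algebraMap F (CompletedAlgClosure F) D.root‖ := by
  rw [← D.norm_algebraMap_root_pow]
  conv_rhs => rw [← pow_one ‖algebraMap F (CompletedAlgClosure F) D.root‖]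
  exact pow_le_pow_of_le_one (norm_nonneg _) D.norm_algebraMap_root_le_one D.e_pos

/-- **`θ_𝒪(z) ≡ (z mod ϖ)♯ (mod ϖ𝒪_{ℂ_F})`**: `‖θ_𝒪(z) − (modVarpi z)♯‖ ≤ ‖ϖ‖` for every `z ∈ A_inf(𝒪)` (write
`z = a₀ + ϖ z'` with `a₀ ∈ 𝔸_inf(F)`; `θ(a₀) ≡ ā₀♯ (mod p)` and `p, ϖ θ_𝒪(z') ∈ ϖ𝒪_{ℂ_F}`).
[cite: FontaineAsterisque223III, Exp. II §1.2.2] [cite: FarguesFontaine2018, §2.2] -/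
theorem norm_theta_sub_untilt_modVarpi_le (z : AinfRam D) :
    ‖((theta D z : integerC F) : CompletedAlgClosure F) - ((PreTilt.untilt (modVarpi D z) : integerC F) : CompletedAlgClosure F)‖ ≤
      ‖algebraMap F (CompletedAlgClosure F) D.root‖ := by
  obtain ⟨q, rfl⟩ := AdjoinRoot.mk_surjective z
  obtain ⟨q', hq'⟩ := Polynomial.X_dvd_iff.2 (show (q - Polynomial.C (q.coeff 0)).coeff 0 = 0 by simp)
  have hz : AdjoinRoot.mk D.polyAinf q =
      algebraMap (Ainf (p := p) F) (AinfRam D) (q.coeff 0) + varpi D * AdjoinRoot.mk D.polyAinf q' := by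
    have : q = Polynomial.C (q.coeff 0) + Polynomial.X * q' := by rw [← hq']; ring
    conv_lhs => rw [this]
    rw [map_add, map_mul, AdjoinRoot.mk_C, AdjoinRoot.mk_X, algebraMap_eq, varpi]
  set a₀ : Ainf (p := p) F := q.coeff 0 with ha₀
  set z' : AinfRam D := AdjoinRoot.mk D.polyAinf q' with hz'
  have hθ : ((theta D (AdjoinRoot.mk D.polyAinf q) : integerC F) : CompletedAlgClosure F) =
      ((fontaineTheta (integerC F) p a₀ : integerC F) : CompletedAlgClosure F) +
        algebraMap F (CompletedAlgClosure F) D.root * ((theta D z' : integerC F) : CompletedAlgClosure F) := by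
    rw [hz, map_add, map_mul, theta_algebraMap, theta_varpi, Subring.coe_add, Subring.coe_mul, EisensteinRoot.coe_rootC]
  have hmod : modVarpi D (AdjoinRoot.mk D.polyAinf q) = WittVector.constantCoeff a₀ := by
    rw [hz, map_add, map_mul, modVarpi_varpi, zero_mul, add_zero, modVarpi_algebraMap]
  obtain ⟨d, hd⟩ := Ideal.mem_span_singleton'.1 (AinfTop.fontaineTheta_sub_untilt_constantCoeff_mem (F := F) (p := p) a₀)
  have hd' : ((fontaineTheta (integerC F) p a₀ : integerC F) : CompletedAlgClosure F) -
      ((PreTilt.untilt (WittVector.constantCoeff a₀) : integerC F) : CompletedAlgClosure F) =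
        ((d : integerC F) : CompletedAlgClosure F) * (p : CompletedAlgClosure F) := by
    have h := congrArg (fun w : integerC F => (w : CompletedAlgClosure F)) hd
    simp only [Subring.coe_mul, Subring.coe_natCast, AddSubgroupClass.coe_sub] at h
    exact h.symm
  rw [hmod, hθ, show ((fontaineTheta (integerC F) p a₀ : integerC F) : CompletedAlgClosure F) +
      algebraMap F (CompletedAlgClosure F) D.root * ((theta D z' : integerC F) : CompletedAlgClosure F) -
      ((PreTilt.untilt (WittVector.constantCoeff a₀) : integerC F) : CompletedAlgClosure F) =
    (((fontaineTheta (integerC F) p a₀ : integerC F) : CompletedAlgClosure F) -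
      ((PreTilt.untilt (WittVector.constantCoeff a₀) : integerC F) : CompletedAlgClosure F)) +
      algebraMap F (CompletedAlgClosure F) D.root * ((theta D z' : integerC F) : CompletedAlgClosure F) by ring, hd']
  refine (IsUltrametricDist.norm_add_le_max _ _).trans (max_le ?_ ?_)
  · rw [norm_mul]
    exact (mul_le_of_le_one_left (norm_nonneg _) (norm_coe_integerC_le d)).trans (norm_natCast_le_norm_root D)
  · rw [norm_mul]
    exact mul_le_of_le_one_right (norm_nonneg _) (norm_coe_integerC_le _)

end AinfRam

/-! ## §2 `ω² ∤ x_t` for a Lubin–Tate division tower with `t₀ = 0 ≠ t₁` (`q ≥ 3`) -/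

namespace AinfRamTop

variable {hθ : Function.Surjective (fontaineTheta (integerC F) p)} {q : ℕ} (hq : q ≠ 0) (hpq : p ∣ q)

omit [Fact (¬ IsUnit (p : integerC F))] [IsAdicComplete (Ideal.span {(p : integerC F)}) (integerC F)] in
/-- The uniformizer `ϖ ∈ 𝒪_D` as a discrete coefficient maps to `ϖ ∈ ℂ_F`. [cite: SerreLocalFields1979, Ch. I §6 Prop. 18] -/
theorem coe_algebraMap_varpiDisc_cBall :
    ((algebraMap (EisensteinRoot.CoeffDisc D) (CBall F) (EisensteinRoot.CoeffDisc.of D (AdjoinRoot.root D.poly)) : CBall F) :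
        CompletedAlgClosure F) = algebraMap F (CompletedAlgClosure F) D.root := by
  rw [EisensteinRoot.coe_algebraMap_coeffDisc_cBall, EisensteinRoot.Coeff.toF_root]

omit [IsAdicComplete (Ideal.span {(p : integerC F)}) (integerC F)] in
/-- The uniformizer `ϖ ∈ 𝒪_D` as a discrete coefficient is `ϖ ∈ A_inf(𝒪)`. [cite: FarguesFontaine2018, §1.2] -/
theorem of_symm_algebraMap_varpiDisc :
    (of D).symm (algebraMap (EisensteinRoot.CoeffDisc D) (AinfRamTop D) (EisensteinRoot.CoeffDisc.of D (AdjoinRoot.root D.poly))) =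
      AinfRam.varpi D := by
  rw [EisensteinRoot.algebraMap_coeffDisc_ainfRamTop, RingEquiv.symm_apply_apply, AinfRam.coeffHom_root]

/-- **`ω² ∤ x_t`**: Fontaine's element of a division tower `t` of the Lubin–Tate polynomial `P = ϖX + X^q` (`q ≥ 3`, `p ∣ q`)
with `t₀ = 0` and `t₁ ≠ 0` does not lie in `ω² A_inf(𝒪) = A_inf(𝒪) ∩ Fil² B_dR⁺` — the tilt-valuation test
`‖x̄_{t⁺}♯‖^q ≤ ‖ϖ‖² < ‖t₁‖^q`. [cite: Tate1967, §3.3] [cite: Colmez1993, §I.2] [cite: FontaineAsterisque223III, Exp. II §1.2.2] -/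
theorem ltTorsionLift_not_dvd_omega_sq (hq3 : 3 ≤ q) {t : ℕ → (maxNilIdealC F).toIdeal}
    (htp : ∀ n, ltStepC (EisensteinRoot.CoeffDisc.of D (AdjoinRoot.root D.poly)) hq (t (n + 1)) = t n)
    (ht0 : (t 0 : CBall F) = 0) (ht1 : (t 1 : CBall F) ≠ 0) :
    ¬ AinfRam.omega D ^ 2 ∣ (of D).symm
      (ltTorsionLift (EisensteinRoot.CoeffDisc.of D (AdjoinRoot.root D.poly)) hq hpq (k := D.e)
        algebraMap_varpiDisc_pow_mem_ideal hθ t htp) := by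
  -- notation
  set c : EisensteinRoot.CoeffDisc D := EisensteinRoot.CoeffDisc.of D (AdjoinRoot.root D.poly) with hc
  set ϖ : CompletedAlgClosure F := algebraMap F (CompletedAlgClosure F) D.root with hϖ
  set x : AinfRamTop D := ltTorsionLift c hq hpq (k := D.e) algebraMap_varpiDisc_pow_mem_ideal hθ t htp with hx
  set T : AinfRamTop D := ltTorsionLift c hq hpq (k := D.e) algebraMap_varpiDisc_pow_mem_ideal hθ (fun m => t (m + 1))
    (ltStepC_shift htp 1) with hT
  set u : CompletedAlgClosure F := ((t 1 : CBall F) : CompletedAlgClosure F) with hu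
  intro hdvd
  -- (A) valuations in `ℂ_F`: `ϖ u + u^q = 0`, `‖u‖^{q-1} = ‖ϖ‖`, `‖ϖ‖ < ‖u‖ < 1`
  have hu1 : ‖u‖ < 1 := (t 1).2
  have hu0 : u ≠ 0 := fun h => ht1 (Subtype.ext h)
  have hupos : 0 < ‖u‖ := norm_pos_iff.2 hu0
  have hrel : ϖ * u + u ^ q = 0 := by
    have h := congrArg (fun z : (maxNilIdealC F).toIdeal => ((z : CBall F) : CompletedAlgClosure F)) (htp 0)
    simp only [coe_ltStepC, Subring.coe_add, Subring.coe_mul, SubmonoidClass.coe_pow, ht0, Subring.coe_zero] at h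
    rw [hc, coe_algebraMap_varpiDisc_cBall] at h
    exact h
  have hnormu : ‖u‖ ^ (q - 1) = ‖ϖ‖ := by
    have h1 : u ^ q = -(ϖ * u) := eq_neg_of_add_eq_zero_right hrel
    have h2 : ‖u‖ ^ (q - 1) * ‖u‖ = ‖ϖ‖ * ‖u‖ := by
      rw [← pow_succ, Nat.sub_add_cancel (by omega), ← norm_pow, h1, norm_neg, norm_mul]
    exact mul_right_cancel₀ hupos.ne' h2
  have hϖu : ‖ϖ‖ < ‖u‖ := by
    rw [← hnormu]
    conv_rhs => rw [← pow_one ‖u‖]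
    exact pow_lt_pow_right_of_lt_one₀ hupos hu1 (by omega)
  -- (B) the shift relation and `θ_𝒪(x_{t⁺}) = t₁`
  have hxT : x = algebraMap (EisensteinRoot.CoeffDisc D) (AinfRamTop D) c * T + T ^ q :=
    coe_ltTorsionLift_eq_shift hpq _ htp
  have hθT : ((AinfRam.theta D ((of D).symm T) : integerC F) : CompletedAlgClosure F) = u := by
    have h := coe_theta (D := D) ((of D).symm T)
    rw [RingEquiv.apply_symm_apply, hT, theta_ltTorsionLift_shift hpq _ htp] at h
    exact h.symm
  -- (C) reduce modulo `ϖ`: `x̄ = T̄^q = (ϖ♭)² ȳ`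
  set Tb : PreTilt (integerC F) p := AinfRam.modVarpi D ((of D).symm T) with hTb
  have hred : AinfRam.modVarpi D ((of D).symm x) = Tb ^ q := by
    rw [hxT, map_add, map_mul, map_pow, map_add, map_mul, map_pow, of_symm_algebraMap_varpiDisc, AinfRam.modVarpi_varpi,
      zero_mul, zero_add]
  obtain ⟨y, hy⟩ := hdvd
  have hred' : Tb ^ q = D.rootFlat ^ 2 * AinfRam.modVarpi D y := by
    rw [← hred, hy, map_mul, map_pow, AinfRam.modVarpi_omega, neg_sq]
  -- (D) untilt and take norms: `‖T̄♯‖^q ≤ ‖ϖ‖²`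
  have hunt := congrArg (fun z : PreTilt (integerC F) p => ((PreTilt.untilt z : integerC F) : CompletedAlgClosure F)) hred'
  simp only [map_mul, map_pow, EisensteinRoot.untilt_rootFlat, Subring.coe_mul, SubmonoidClass.coe_pow,
    EisensteinRoot.coe_rootC] at hunt
  have hle : ‖((PreTilt.untilt Tb : integerC F) : CompletedAlgClosure F)‖ ^ q ≤ ‖ϖ‖ ^ 2 := by
    have h := congrArg (fun z => ‖z‖) hunt
    simp only [norm_mul, norm_pow] at h
    rw [h, hϖ]
    exact mul_le_of_le_one_right (pow_nonneg (norm_nonneg _) _) (norm_coe_integerC_le _)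
  -- (E) `‖T̄♯‖ = ‖u‖` by §1 (`‖θ_𝒪(T) − T̄♯‖ ≤ ‖ϖ‖ < ‖u‖`)
  have hTu : ‖((PreTilt.untilt Tb : integerC F) : CompletedAlgClosure F)‖ = ‖u‖ := by
    have h1 := AinfRam.norm_theta_sub_untilt_modVarpi_le D ((of D).symm T)
    rw [hθT] at h1
    set b : CompletedAlgClosure F := ((PreTilt.untilt Tb : integerC F) : CompletedAlgClosure F) with hb
    have hlt : ‖u - b‖ < ‖u‖ := h1.trans_lt hϖu
    have hne : ‖u‖ ≠ ‖-(u - b)‖ := by rw [norm_neg]; exact (ne_of_lt hlt).symm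
    have h := IsUltrametricDist.norm_add_eq_max_of_norm_ne_norm hne
    rw [show u + -(u - b) = b by ring, norm_neg, max_eq_left hlt.le] at h
    exact h
  rw [hTu, ← hnormu, ← pow_mul] at hle
  -- contradiction: `‖u‖^q ≤ ‖u‖^{2(q-1)} < ‖u‖^q`
  have hlt : ‖u‖ ^ ((q - 1) * 2) < ‖u‖ ^ q := pow_lt_pow_right_of_lt_one₀ hupos hu1 (by omega)
  exact absurd (hle.trans_lt hlt) (lt_irrefl _)

end AinfRamTop

end Literature.NumberTheory.PAdicHodge

end
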